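import Mathlib
import HarnessLib
import Summits.BirchSwinnertonDyer.BirchSwinnertonDyer.Theorems.SylvesterTwoHeegnerIndexUnramifiedQuadraticCharacters

/-!
# Route `SylvesterTwoHeegnerIndex` (rung K7t): the `ℤ₂[ω]`-linear algebra of ROAD (k), PART VI —
# TRIANGULAR SYSTEMS: a triangular dual system is independent (McCallum's «triangular basis»,
# memo §64.5 SET-UP / STEP k → k+1), the detection hypotheses from the order discipline, and the
# exponent of a complement by the `#2^N·` count

Cell `bsd-cm`, seat `bsd-cm-k7t-c2` (prover-bsd-cm-k7t-c2-g16-0; hand item 19229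
`HeegnerIndexUpperAtTwoHSY`: verdict unchanged, NOT FOUND as a theorem — fact-free, equivalent modulo
the route's facts to `MissingUpperBoundAt B 2`, open as a class). PARTITION (D-0054): CornerF at `p = 2`
(B14/O12) × 𝒞_HSY (`E_p : x³ + y³ = p`) × `p = 2` — types-the-object-of: the linear algebra of the
induction in THEOREM K3 = [McC91 Thm 5.4] transposed (memo two = `HOME/MEMO-bsd-cm-two.md` v2.20 §64.5;
ROAD (k); line card `Cruxes/UpperOffV0HSYPlus/Lines/cmframe-kolyvagin2.md`, skeleton of record VARIANT J
`Cruxes/UpperOffV0HSYPlus/Lines/coupled_variantJ.lean`, stub (K3-4) = THEOREM K3 typed), closing the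
LEMMA D series (Parts I–V: `…Descent` p553247, `…Pairings` p571041, `…Orders` p576537, `…Hilbert90`
p578952, `…Characters` p581026). Kernel helper `--supports stmt-BirchSwinnertonDyer-19804 --as helper`
(planner GO STATUS l.1738, conditional pre-authorisation of Part VI met); closes no cell and no item; moves
no label; BSD is not claimed; THEOREM K3 stays a PAPER theorem — nothing below is an Euler-system
statement. Everything is PROVED abstract algebra over Mathlib: no definition, no named fact, no
instance, no notation, no `sorry`. SERIES FENCE (planner l.1738): no Part VII by reseat.

SETTING. `A` an additive group (the memo's `Ш(X/K)[2^∞]`, or `𝒜 = Ш(A/K) ⊕ Ш(B/K)`), `Q` an additive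
group and a biadditive `B : A →+ A →+ Q` (the Cassels–Tate form; for the `𝒪`-structure `w` with
`w² + w + 1 = 0` it is `𝒪`-BALANCED, `B (w a) b = B a (w̄ b)`, `w̄ = −1 − w`, and the sesquilinear
refinement `(( , ))` of Part II is displayed as «`((a, b)) = 0 ↔ B a b = 0 ∧ B (w a) b = 0`»,
`refine_eq_zero_iff`). McCallum's data [McC91 p. 288; memo §64.5 SET-UP]: cyclic lines
`D_i = 𝒪 d_i` spanning a maximal ISOTROPIC `D = ⊕ D_i`, and classes `e_i = d_{χ_i,M_{i−1}}(n_i)` whose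
functionals `κ_i = ((e_i, ·))` form a TRIANGULAR system: `κ_i(D_j) = 0` for `j > i` and `κ_i|_{D_i}`
of full order. Below the lines are arbitrary subgroups `D i`, `E i` (`i : Fin k`) and «full order on
the diagonal» is the pair of DETECTION hypotheses `u ∈ E_i, B(u, D_i) = 0 ⇒ u = 0` and
`v ∈ D_i, B(E_i, v) = 0 ⇒ v = 0` — which §C derives, for `𝒪`-lines, from the ORDER DISCIPLINE of
Part III (valuation form).

WHAT IS PROVED, AND WHERE ROAD (k) USES IT ([McC91] = W. G. McCallum, *Kolyvagin's work on
Shafarevich–Tate groups*, LMS LN 153 (1991), Thm 5.4 pp. 288–290).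
* §A **TRIANGULAR INDEPENDENCE** (`eq_zero_of_triangular`): under isotropy of the `D_i`,
  triangularity `B(E_i, D_j) = 0 (i < j)` and the two detection hypotheses, a vanishing sum
  `Σ x_i + Σ y_i = 0` with `x_i ∈ D_i`, `y_i ∈ E_i` has ALL TERMS ZERO (downward induction pairing
  with `D_i`, then upward induction pairing with `E_j`); hence the sum map
  `(Π D_i) × (Π E_i) → A` is injective (`sum_injective_of_triangular`) and its image has exactly
  `∏ #D_i · ∏ #E_i` elements (`card_range_sum_of_triangular`). USE: memo §64.5 STEP k → k+1, «the κ_i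
  are a triangular system DUAL to the d_i, so `{d_i, d_{χ_i}(n_i)}_{i ≤ k}` span a direct summand
  `≅ ⊕_{i ≤ k}(O₂/2^{N_i})²`» and «`O·d_{χ_k}(n_k) ∩ D = 0` since `D` is isotropic and
  `ord d(n_k) = ord κ_k`» (= `eq_zero_of_mem_isotropic`, the one-line case) — [McC91 p. 288–289]'s
  «triangular basis … independent» bookkeeping, with «eigenspace» ↦ «curve» immaterial here.
* §B **EXPONENT OF A COMPLEMENT BY COUNTING** (`two_pow_smul_mem_of_card_le`,
  `two_pow_smul_eq_zero_of_inf_eq_bot`): if `#(2^N·A) ≤ #(2^N·W)` (finite `A`) then `2^N·A ⊆ W`, so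
  every `c` with `ℤc ∩ W = 0` is killed by `2^N`. USE: memo §64.5 converse step «`2^{N_{k+1}}` is the
  maximal order of `c ∈ S_∞(X_{k+1}/K)` with `O·c ∩ C = 0` — McC's implicit linear algebra, unchanged
  over the DVR `O₂`»: with `W` the span of §A and the elementary divisors `N_1 ≥ N_2 ≥ …` of the
  curve, `2^{N_{k+1}}·W` and `2^{N_{k+1}}·Ш` have the same order `∏_{i ≤ k} 4^{2(N_i − N_{k+1})}`.
* §C **DETECTION FROM THE ORDER DISCIPLINE** (`eq_zero_of_pairing_eq_zero_of_valuation`, left, and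
  `…_valuation'`, right): on an `𝒪`-line `𝒪e` with `2^N e = 0`, if `((2^a e, d)) = 0 ⇒ N ≤ a`
  (Part III `pairing_two_pow_eq_zero_iff`, valuation form of «`((e, d))` generates `2^{−N}O/O`»), then
  `((u, d)) = 0 ⇒ u = 0` for every `u ∈ 𝒪e` (write `u = 2^a·(unit)·e` by Part III
  `exists_two_pow_mul_not_both_even` / `generator_of_not_two_dvd`); and the ORDER TRANSFER
  `le_of_two_pow_smul_eq_zero` («`ord d(n_i) ≥ ord κ_i ≥ 2^{N_i}`», i.e. `2^c e = 0 ⇒ N ≤ c` — the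
  inequality `N_i ≤ M_{i−1} − M_i` of §64.5 once `2^{M_{i−1}−M_i}` kills the class by (P3)).

References: [McC91] Thm 5.4, Cor 5.5–5.6, Prop 5.7; memo two §59.1 (iii), §64.5; Parts II–III.
-/

set_option autoImplicit false
set_option linter.dupNamespace false

namespace Summit.BirchSwinnertonDyer.BirchSwinnertonDyer.Theorems.SylvesterTwoUnramifiedTriangular

open Summit.BirchSwinnertonDyer.BirchSwinnertonDyer.Theorems.SylvesterTwoUnramifiedDescent
open Summit.BirchSwinnertonDyer.BirchSwinnertonDyer.Theorems.SylvesterTwoUnramifiedPairings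
open Summit.BirchSwinnertonDyer.BirchSwinnertonDyer.Theorems.SylvesterTwoUnramifiedOrders

variable {A : Type*} [AddCommGroup A] {Q : Type*} [AddCommGroup Q]

/-! ### §A Triangular independence -/

/-- **ONE LINE AGAINST AN ISOTROPIC SUBGROUP** (the case `k = 1`): if `D` is isotropic for `B` and
`u ∈ E` is detected by `D` (`B(u, D) = 0 ⇒ u = 0`), then `u ∈ D ⇒ u = 0`, i.e. `E ∩ D = 0`.
[memo §64.5 STEP k → k+1: «since `D` is isotropic and `ord d_{χ_k}(n_k) = ord κ_k`,
`O·d_{χ_k}(n_k) ∩ D = 0`» = [McC91 p. 289, before (21)].] -/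
theorem eq_zero_of_mem_isotropic (B : A →+ A →+ Q) (D : AddSubgroup A)
    (hiso : ∀ u ∈ D, ∀ v ∈ D, B u v = 0) {u : A}
    (hdet : (∀ v ∈ D, B u v = 0) → u = 0) (hu : u ∈ D) : u = 0 :=
  hdet fun v hv => hiso u hu v hv

/-- **TRIANGULAR INDEPENDENCE.** Subgroups `D i`, `E i` (`i : Fin k`) of `A` with: (iso) `B(D_i, D_j) = 0`
for all `i, j`; (tri) `B(E_i, D_j) = 0` for `i < j`; (detE) `u ∈ E_i`, `B(u, D_i) = 0 ⇒ u = 0`;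
(detD) `v ∈ D_i`, `B(E_i, v) = 0 ⇒ v = 0`. If `x_i ∈ D_i`, `y_i ∈ E_i` and `Σ x_i + Σ y_i = 0` then
every `x_i` and every `y_i` is `0`. PROOF: pairing the sum with `v ∈ D_i` kills the `x`-terms
(iso) and the `y_{i'}`-terms for `i' < i` (tri), so by DOWNWARD induction `B(y_i, D_i) = 0`, whence
`y_i = 0` (detE); then pairing `u ∈ E_j` with `Σ x_i = 0` kills the terms `i' > j` (tri), so by
UPWARD induction `B(E_j, x_j) = 0`, whence `x_j = 0` (detD). [McC91 Thm 5.4, p. 288: «a triangular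
basis `κ_1, …, κ_k` … `κ_i(D_j) = 0` for `j > i`»; memo §64.5: «the κ_i are a triangular system DUAL
to the d_i, so `{d_i, d_{χ_i}(n_i)}` span a direct summand».] -/
theorem eq_zero_of_triangular {k : ℕ} (B : A →+ A →+ Q) (D E : Fin k → AddSubgroup A)
    (hiso : ∀ i j, ∀ u ∈ D i, ∀ v ∈ D j, B u v = 0)
    (htri : ∀ i j, i < j → ∀ u ∈ E i, ∀ v ∈ D j, B u v = 0)
    (hdetE : ∀ i, ∀ u ∈ E i, (∀ v ∈ D i, B u v = 0) → u = 0)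
    (hdetD : ∀ i, ∀ v ∈ D i, (∀ u ∈ E i, B u v = 0) → v = 0)
    {x y : Fin k → A} (hx : ∀ i, x i ∈ D i) (hy : ∀ i, y i ∈ E i)
    (hsum : ∑ i, x i + ∑ i, y i = 0) : (∀ i, x i = 0) ∧ ∀ i, y i = 0 := by
  -- Step 1 (downward): `y i = 0` as soon as all later `y i'` vanish
  have stepy : ∀ i : Fin k, (∀ i', i < i' → y i' = 0) → y i = 0 := by
    intro i hlater
    apply hdetE i (y i) (hy i)
    intro v hv
    have h0 : B (∑ i', x i' + ∑ i', y i') v = 0 := by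
      rw [hsum, map_zero, AddMonoidHom.zero_apply]
    rw [map_add, map_sum, map_sum, AddMonoidHom.add_apply, AddMonoidHom.finsetSum_apply,
      AddMonoidHom.finsetSum_apply] at h0
    have hxv : ∑ i', B (x i') v = 0 :=
      Finset.sum_eq_zero fun i' _ => hiso i' i (x i') (hx i') v hv
    have hyv : ∑ i', B (y i') v = B (y i) v := by
      rw [Finset.sum_eq_single i]
      · intro i' _ hne
        rcases lt_or_gt_of_ne hne with hlt | hgt
        · exact htri i' i hlt (y i') (hy i') v hv
        · rw [hlater i' hgt, map_zero, AddMonoidHom.zero_apply]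
      · intro h
        exact absurd (Finset.mem_univ i) h
    rwa [hxv, hyv, zero_add] at h0
  have hy0 : ∀ i, y i = 0 := by
    have key : ∀ n : ℕ, ∀ i : Fin k, k ≤ i.val + n → y i = 0 := by
      intro n
      induction n with
      | zero =>
        intro i hi
        exact absurd i.isLt (not_lt.mpr (by simpa using hi))
      | succ n ih =>
        intro i hi
        refine stepy i fun i' hi' => ih i' ?_
        have := Fin.lt_def.mp hi'
        omega
    exact fun i => key k i (by omega)
  -- Step 2 (upward): with the `y` gone, `x j = 0` as soon as all earlier `x j'` vanish
  have hsumx : ∑ i, x i = 0 := by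
    have hy' : ∑ i, y i = 0 := Finset.sum_eq_zero fun i _ => hy0 i
    rwa [hy', add_zero] at hsum
  have stepx : ∀ j : Fin k, (∀ j', j' < j → x j' = 0) → x j = 0 := by
    intro j hearlier
    apply hdetD j (x j) (hx j)
    intro u hu
    have h0 : B u (∑ j', x j') = 0 := by rw [hsumx, map_zero]
    rw [map_sum, Finset.sum_eq_single j] at h0
    · exact h0
    · intro j' _ hne
      rcases lt_or_gt_of_ne hne with hlt | hgt
      · rw [hearlier j' hlt, map_zero]
      · exact htri j j' hgt u hu (x j') (hx j')
    · intro h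
      exact absurd (Finset.mem_univ j) h
  have hx0 : ∀ j, x j = 0 := by
    have key : ∀ n : ℕ, ∀ j : Fin k, j.val < n → x j = 0 := by
      intro n
      induction n with
      | zero => intro j hj; exact absurd hj (Nat.not_lt_zero _)
      | succ n ih =>
        intro j _
        refine stepx j fun j' hj' => ih j' ?_
        have := Fin.lt_def.mp hj'
        omega
    exact fun j => key (j.val + 1) j (Nat.lt_succ_self _)
  exact ⟨hx0, hy0⟩

/-- **THE SUM MAP `(Π D_i) × (Π E_i) → A` IS INJECTIVE** under the hypotheses of
`eq_zero_of_triangular`: the `2k` subgroups are INDEPENDENT (their sum is direct). [memo §64.5: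
«`{d_i, d_{χ_i}(n_i)}_{i ≤ k}` span `≅ ⊕_{i ≤ k}(O₂/2^{N_i})²`»; McC91 Prop 5.7 (generation by
Kolyvagin classes) rests on the same independence.] -/
theorem sum_injective_of_triangular {k : ℕ} (B : A →+ A →+ Q) (D E : Fin k → AddSubgroup A)
    (hiso : ∀ i j, ∀ u ∈ D i, ∀ v ∈ D j, B u v = 0)
    (htri : ∀ i j, i < j → ∀ u ∈ E i, ∀ v ∈ D j, B u v = 0)
    (hdetE : ∀ i, ∀ u ∈ E i, (∀ v ∈ D i, B u v = 0) → u = 0)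
    (hdetD : ∀ i, ∀ v ∈ D i, (∀ u ∈ E i, B u v = 0) → v = 0) :
    Function.Injective fun p : (Π i, D i) × (Π i, E i) =>
      ∑ i, (p.1 i : A) + ∑ i, (p.2 i : A) := by
  intro p p' hpp
  simp only at hpp
  have hsum : ∑ i, ((p.1 i : A) - p'.1 i) + ∑ i, ((p.2 i : A) - p'.2 i) = 0 := by
    rw [Finset.sum_sub_distrib, Finset.sum_sub_distrib, ← sub_eq_zero.mpr hpp]
    abel
  have h := eq_zero_of_triangular B D E hiso htri hdetE hdetD
    (x := fun i => (p.1 i : A) - p'.1 i) (y := fun i => (p.2 i : A) - p'.2 i)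
    (fun i => (D i).sub_mem (p.1 i).2 (p'.1 i).2) (fun i => (E i).sub_mem (p.2 i).2 (p'.2 i).2) hsum
  refine Prod.ext (funext fun i => Subtype.ext ?_) (funext fun i => Subtype.ext ?_)
  · exact sub_eq_zero.mp (h.1 i)
  · exact sub_eq_zero.mp (h.2 i)

/-- **THE SPAN HAS EXACTLY `∏ #D_i · ∏ #E_i` ELEMENTS**: the image of the sum map is in bijection
with `(Π D_i) × (Π E_i)`. [memo §64.5: with `D_i ≅ E_i ≅ O₂/2^{N_i}` (`#` = `4^{N_i}`, Part V
`card_line_eq`) the span of `{d_i, d_{χ_i}(n_i)}_{i ≤ k}` has order `∏_{i ≤ k} 16^{N_i}` =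
`#⊕_{i ≤ k}(O₂/2^{N_i})²`.] -/
theorem card_range_sum_of_triangular {k : ℕ} (B : A →+ A →+ Q) (D E : Fin k → AddSubgroup A)
    (hiso : ∀ i j, ∀ u ∈ D i, ∀ v ∈ D j, B u v = 0)
    (htri : ∀ i j, i < j → ∀ u ∈ E i, ∀ v ∈ D j, B u v = 0)
    (hdetE : ∀ i, ∀ u ∈ E i, (∀ v ∈ D i, B u v = 0) → u = 0)
    (hdetD : ∀ i, ∀ v ∈ D i, (∀ u ∈ E i, B u v = 0) → v = 0) :
    Nat.card (Set.range fun p : (Π i, D i) × (Π i, E i) =>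
      ∑ i, (p.1 i : A) + ∑ i, (p.2 i : A)) = (∏ i, Nat.card (D i)) * ∏ i, Nat.card (E i) := by
  rw [← Nat.card_congr (Equiv.ofInjective _ (sum_injective_of_triangular B D E hiso htri hdetE hdetD)),
    Nat.card_prod, Nat.card_pi, Nat.card_pi]

/-! ### §B The exponent of a complement, by counting `2^N`-multiples -/

/-- **`#(2^N·A) ≤ #(2^N·W)` FORCES `2^N·A ⊆ W`** (finite `A`): `2^N·W ⊆ 2^N·A` always, so the count makes
them equal, and `2^N·W ⊆ W`. [memo §64.5, converse step: with `W` = the span of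
`{d_i, d_{χ_i}(n_i)}_{i ≤ k}` `≅ ⊕_{i ≤ k}(O₂/2^{N_i})²` inside `Ш(X/K)[2^∞] ≅ ⊕_i (O₂/2^{N_i})²`
(`N_1 ≥ N_2 ≥ …` the curve's elementary divisors), both `2^{N_{k+1}}·W` and `2^{N_{k+1}}·Ш` have order
`∏_{i ≤ k} 16^{N_i − N_{k+1}}` — the elementary-divisor count that replaces Krull–Schmidt.] -/
theorem two_pow_smul_mem_of_card_le [Finite A] (W : AddSubgroup A) (N : ℕ)
    (hcard : Nat.card ((⊤ : AddSubgroup A).map (DistribSMul.toAddMonoidHom A ((2 : ℤ) ^ N))) ≤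
      Nat.card (W.map (DistribSMul.toAddMonoidHom A ((2 : ℤ) ^ N)))) (g : A) :
    (2 : ℤ) ^ N • g ∈ W := by
  have hle : W.map (DistribSMul.toAddMonoidHom A ((2 : ℤ) ^ N)) ≤
      (⊤ : AddSubgroup A).map (DistribSMul.toAddMonoidHom A ((2 : ℤ) ^ N)) :=
    AddSubgroup.map_mono le_top
  have heq := AddSubgroup.eq_of_le_of_card_ge hle hcard
  have hg : (2 : ℤ) ^ N • g ∈ (⊤ : AddSubgroup A).map (DistribSMul.toAddMonoidHom A ((2 : ℤ) ^ N)) :=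
    ⟨g, AddSubgroup.mem_top g, rfl⟩
  rw [← heq] at hg
  obtain ⟨w', hw', hw'g⟩ := hg
  rw [← hw'g]
  exact W.zsmul_mem hw' _

/-- **EXPONENT OF A COMPLEMENT**: if `2^N·A ⊆ W` and the cyclic group `ℤc` meets `W` trivially, then
`2^N c = 0`. [memo §64.5: «`2^{N_{k+1}}` is the maximal order of `c ∈ S_∞(X_{k+1}/K)` with
`O·c ∩ C = 0`» — «McC's implicit linear algebra, unchanged over the DVR `O₂`»; with
`two_pow_smul_mem_of_card_le` the hypothesis is a COUNT of `2^{N_{k+1}}`-multiples.] -/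
theorem two_pow_smul_eq_zero_of_inf_eq_bot (W : AddSubgroup A) {N : ℕ}
    (hW : ∀ g : A, (2 : ℤ) ^ N • g ∈ W) {c : A}
    (hc : AddSubgroup.zmultiples c ⊓ W = ⊥) : (2 : ℤ) ^ N • c = 0 := by
  have hmem : (2 : ℤ) ^ N • c ∈ AddSubgroup.zmultiples c ⊓ W :=
    ⟨AddSubgroup.zsmul_mem _ (AddSubgroup.mem_zmultiples c) _, hW c⟩
  rw [hc] at hmem
  exact (AddSubgroup.mem_bot).mp hmem

/-! ### §C Detection on an `𝒪`-line from the order discipline -/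

section Line

variable (w : A →+ A)

/-- **ORDER TRANSFER** («`ord e ≥ ord κ(e)`»): if `((2^a e, d)) = 0` only for `N ≤ a` (the valuation
form of «`((e, d))` has exact order `2^N`», Part III `pairing_two_pow_eq_zero_iff`), then
`2^c e = 0 ⇒ N ≤ c`. [memo §64.5 STEP `i = 1` / k → k+1: `ord d_{χ_i,M_{i−1}}(n_i) ≥ ord κ_i ≥ 2^{N_i}`
while `2^{M_{i−1} − M_i}` kills the class by (P3) — hence `N_i ≤ M_{i−1} − M_i`.] -/
theorem le_of_two_pow_smul_eq_zero (B : A →+ A →+ Q) {e d : A} {N : ℕ}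
    (hval : ∀ a : ℕ, B ((2 : ℤ) ^ a • e) d = 0 → B (w ((2 : ℤ) ^ a • e)) d = 0 → N ≤ a)
    {c : ℕ} (hc : (2 : ℤ) ^ c • e = 0) : N ≤ c :=
  hval c (by rw [hc, map_zero, AddMonoidHom.zero_apply]) (by rw [hc, map_zero, map_zero,
    AddMonoidHom.zero_apply])

/-- `𝒪`-combinations pass through the left argument: `B (m z + n ωz) d = 0` and `B (ω(m z + n ωz)) d = 0`
as soon as `B z d = B (ωz) d = 0`. -/
theorem pairing_span_left_eq_zero (hw : ∀ x, w (w x) + w x + x = 0) (B : A →+ A →+ Q) {z d : A}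
    (h1 : B z d = 0) (h2 : B (w z) d = 0) (m n : ℤ) :
    B (m • z + n • w z) d = 0 ∧ B (w (m • z + n • w z)) d = 0 := by
  have e : w (w z) = -(w z) - z := by
    rw [← sub_eq_zero]; rw [← hw z]; abel
  refine ⟨?_, ?_⟩
  · rw [map_add, map_zsmul, map_zsmul, AddMonoidHom.add_apply, AddMonoidHom.zsmul_apply,
      AddMonoidHom.zsmul_apply, h1, h2, smul_zero, smul_zero, add_zero]
  · rw [map_add, map_zsmul, map_zsmul, e, map_add, map_zsmul, map_zsmul, map_sub, map_neg,
      AddMonoidHom.add_apply, AddMonoidHom.zsmul_apply, AddMonoidHom.zsmul_apply,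
      AddMonoidHom.sub_apply, AddMonoidHom.neg_apply, h1, h2]
    simp

/-- **DETECTION ON AN `𝒪`-LINE (left)**: `𝒪e` a line with `2^N e = 0`, `d ∈ A`; if `((2^a e, d)) = 0`
forces `N ≤ a` (valuation form of «`κ(d) = ((e, d))` has full order `2^N = ord e`»), then every
`u = m e + n ωe` with `((u, d)) = 0` is `0`. (Write `(m, n) = 2^a (m′, n′)` with `m′ + n′ω ∉ 2𝒪`, a
unit modulo `2^N` by Part III `generator_of_not_two_dvd`: `e ∈ 𝒪·u′`, `u = 2^a u′`; then
`((2^a e, d)) = 0`, so `N ≤ a`, so `2^a` kills `e`, `u′` and `u`.) This discharges hypothesis (detE) of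
`eq_zero_of_triangular` for McCallum's data. -/
theorem eq_zero_of_pairing_eq_zero_of_valuation (hw : ∀ x, w (w x) + w x + x = 0)
    (B : A →+ A →+ Q) {e d : A} {N : ℕ} (hN : (2 : ℤ) ^ N • e = 0)
    (hval : ∀ a : ℕ, B ((2 : ℤ) ^ a • e) d = 0 → B (w ((2 : ℤ) ^ a • e)) d = 0 → N ≤ a)
    {m n : ℤ} (h1 : B (m • e + n • w e) d = 0) (h2 : B (w (m • e + n • w e)) d = 0) :
    m • e + n • w e = 0 := by
  by_cases hmn : m = 0 ∧ n = 0
  · rw [hmn.1, hmn.2, zero_smul, zero_smul, add_zero]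
  obtain ⟨a, m', n', hodd, hm, hn⟩ := exists_two_pow_mul_not_both_even m n (not_and_or.mp hmn)
  -- `u = 2^a u′` with `u′ = m′ e + n′ ωe` a unit multiple of `e`
  have hu : m • e + n • w e = (2 : ℤ) ^ a • (m' • e + n' • w e) := by
    rw [hm, hn, smul_add, smul_smul, smul_smul]
  obtain ⟨m'', n'', he⟩ := generator_of_not_two_dvd w hw hN hodd
  -- `2^a e` is an `𝒪`-combination of `u` and `ωu`, so it pairs to zero with `d`
  have h2ae : (2 : ℤ) ^ a • e = m'' • (m • e + n • w e) + n'' • w (m • e + n • w e) := by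
    rw [hu, map_zsmul, smul_comm m'' ((2 : ℤ) ^ a), smul_comm n'' ((2 : ℤ) ^ a), ← smul_add, ← he]
  obtain ⟨k1, k2⟩ := pairing_span_left_eq_zero w hw B h1 h2 m'' n''
  rw [← h2ae] at k1 k2
  have hNa : N ≤ a := hval a k1 k2
  -- hence `2^a` kills `e`, and `u = 2^a u′ = 0`
  obtain ⟨c, hc⟩ := Nat.exists_eq_add_of_le hNa
  have h2a : (2 : ℤ) ^ a • e = 0 := by rw [hc, pow_add, mul_comm, mul_smul, hN, smul_zero]
  rw [hu, smul_add, smul_smul, smul_smul, mul_comm _ m', mul_comm _ n', ← smul_smul, ← smul_smul,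
    ← map_zsmul w ((2 : ℤ) ^ a), h2a, smul_zero, map_zero, smul_zero, add_zero]

/-- `𝒪`-combinations pass through the RIGHT argument of a BALANCED `B` (`B (ωa) b = B a (w̄ b)`):
`B e (m z + n ωz) = 0` and `B (ωe) (m z + n ωz) = 0` as soon as `B e z = B (ωe) z = 0`. -/
theorem pairing_span_right_eq_zero (hw : ∀ x, w (w x) + w x + x = 0) (B : A →+ A →+ Q)
    (hB : ∀ a b, B (w a) b = B a (-b - w b)) {e z : A}
    (h1 : B e z = 0) (h2 : B (w e) z = 0) (m n : ℤ) :
    B e (m • z + n • w z) = 0 ∧ B (w e) (m • z + n • w z) = 0 := by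
  have hr : ∀ a : A, B a (w z) = -(B a z) - B (w a) z := fun a => pairing_right_w₂ w w B hB a z
  have e2 : w (w e) = -(w e) - e := by
    rw [← sub_eq_zero]; rw [← hw e]; abel
  refine ⟨?_, ?_⟩
  · rw [map_add, map_zsmul, map_zsmul, hr, h1, h2]; simp
  · rw [map_add, map_zsmul, map_zsmul, hr, e2, map_sub, map_neg, AddMonoidHom.sub_apply,
      AddMonoidHom.neg_apply, h1, h2]
    simp

/-- **GENERATOR PAIRS SUFFICE**: for a balanced `B`, `((z, d)) = 0` (i.e. `B z d = B (ωz) d = 0`)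
already gives `B u v = 0` for ALL `u ∈ 𝒪z`, `v ∈ 𝒪d` — so the hypotheses (iso)/(tri) of
`eq_zero_of_triangular` for the lines `𝒪d_i`, `𝒪e_i` reduce to the generator statements
`((d_i, d_j)) = 0`, `((e_i, d_j)) = 0 (i < j)` of memo §64.5 ((18′)/(19′)/(23′): `c_{i,λ_j} = 0`). -/
theorem pairing_span_span_eq_zero (hw : ∀ x, w (w x) + w x + x = 0) (B : A →+ A →+ Q)
    (hB : ∀ a b, B (w a) b = B a (-b - w b)) {z d : A} (h1 : B z d = 0) (h2 : B (w z) d = 0)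
    (m n m' n' : ℤ) : B (m • z + n • w z) (m' • d + n' • w d) = 0 := by
  obtain ⟨k1, k2⟩ := pairing_span_right_eq_zero w hw B hB h1 h2 m' n'
  exact (pairing_span_left_eq_zero w hw B k1 k2 m n).1

/-- **DETECTION ON AN `𝒪`-LINE (right)**: `B` balanced, `𝒪d` a line with `2^N d = 0`, `e ∈ A`; if
`((e, 2^a d)) = 0` forces `N ≤ a`, then every `v = m d + n ωd` with `((e, v)) = 0` is `0`. This
discharges hypothesis (detD) of `eq_zero_of_triangular`. [Part III `pairing_two_pow_eq_zero_iff'`.] -/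
theorem eq_zero_of_pairing_eq_zero_of_valuation' (hw : ∀ x, w (w x) + w x + x = 0)
    (B : A →+ A →+ Q) (hB : ∀ a b, B (w a) b = B a (-b - w b)) {e d : A} {N : ℕ}
    (hN : (2 : ℤ) ^ N • d = 0)
    (hval : ∀ a : ℕ, B e ((2 : ℤ) ^ a • d) = 0 → B (w e) ((2 : ℤ) ^ a • d) = 0 → N ≤ a)
    {m n : ℤ} (h1 : B e (m • d + n • w d) = 0) (h2 : B (w e) (m • d + n • w d) = 0) :
    m • d + n • w d = 0 := by
  by_cases hmn : m = 0 ∧ n = 0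
  · rw [hmn.1, hmn.2, zero_smul, zero_smul, add_zero]
  obtain ⟨a, m', n', hodd, hm, hn⟩ := exists_two_pow_mul_not_both_even m n (not_and_or.mp hmn)
  have hv : m • d + n • w d = (2 : ℤ) ^ a • (m' • d + n' • w d) := by
    rw [hm, hn, smul_add, smul_smul, smul_smul]
  obtain ⟨m'', n'', hd⟩ := generator_of_not_two_dvd w hw hN hodd
  have h2ad : (2 : ℤ) ^ a • d = m'' • (m • d + n • w d) + n'' • w (m • d + n • w d) := by
    rw [hv, map_zsmul, smul_comm m'' ((2 : ℤ) ^ a), smul_comm n'' ((2 : ℤ) ^ a), ← smul_add, ← hd]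
  obtain ⟨k1, k2⟩ := pairing_span_right_eq_zero w hw B hB h1 h2 m'' n''
  rw [← h2ad] at k1 k2
  have hNa : N ≤ a := hval a k1 k2
  obtain ⟨c, hc⟩ := Nat.exists_eq_add_of_le hNa
  have h2a : (2 : ℤ) ^ a • d = 0 := by rw [hc, pow_add, mul_comm, mul_smul, hN, smul_zero]
  rw [hv, smul_add, smul_smul, smul_smul, mul_comm _ m', mul_comm _ n', ← smul_smul, ← smul_smul,
    ← map_zsmul w ((2 : ℤ) ^ a), h2a, smul_zero, map_zero, smul_zero, add_zero]

end Line

end Summit.BirchSwinnertonDyer.BirchSwinnertonDyer.Theorems.SylvesterTwoUnramifiedTriangular
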